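import Summits.MatrixMultiplication.MatrixMultiplication.Theorems.NilpotentLieHostsUnitriangularCostShapeModelLift

/-!
# `UnitriangularCostShape` — Product model, part 11: reduction to upper monomials, recipes, dimension count, readings

Crux `stmt-MatrixMultiplication-7724` (`NilpotentLieHosts.UnitriangularCostShape`), line `registered`
(`Cruxes/UnitriangularCostShape/Lines/birth.lean`), stub `stub_productModel` (the Weyl-type product model of
`U(u_d)/I^(s+1)` over the truncated Casimir algebra, `b = k = ⌊d/2⌋`).  Helper vocabulary and lemmas, namespace
`…Theorems.UnitriangularCostShape.ProductModel`.

`red` and `eval_red`, `exists_recipe` (every polynomial of weighted degree `≤ s` is, on unitriangular matrices, a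
finite combination of slices with small data), the count `2 · #q-variables + ⌊d/2⌋ ≤ C(d,2)`, the complexification
`cmat` and the reading functionals `ell`.
-/

set_option linter.dupNamespace false

noncomputable section

namespace Summit.MatrixMultiplication.MatrixMultiplication.Theorems.UnitriangularCostShape.ProductModel

open MvPolynomial
open scoped BigOperators

variable {d : ℕ}

/-- Restriction to upper unitriangular matrices: diagonal entries `↦ 1`, lower entries `↦ 0`. -/
def red (d : ℕ) : A d →ₐ[ℂ] A d :=
  aeval fun ij : Fin d × Fin d => if ij.1 < ij.2 then X ij else if ij.1 = ij.2 then 1 else 0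

/-- On an upper unitriangular matrix, `p` and its reduction have the same value. -/
theorem eval_red {g : Matrix (Fin d) (Fin d) ℂ} (hg : ∀ i j : Fin d, j ≤ i → g i j = if i = j then 1 else 0)
    (p : A d) : eval (fun ij : Fin d × Fin d => g ij.1 ij.2) (red d p) =
      eval (fun ij : Fin d × Fin d => g ij.1 ij.2) p := by
  have : (eval fun ij : Fin d × Fin d => g ij.1 ij.2).comp (red d : A d →+* A d) =
      eval (fun ij : Fin d × Fin d => g ij.1 ij.2) := by
    refine MvPolynomial.ringHom_ext (fun r => ?_) (fun ij => ?_)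
    · rw [RingHom.comp_apply, RingHom.coe_coe, MvPolynomial.algHom_C, MvPolynomial.algebraMap_eq, eval_C]
    · rw [RingHom.comp_apply, RingHom.coe_coe, red, aeval_X, eval_X]
      split_ifs with h1 h2
      · rw [eval_X]
      · rw [map_one, hg ij.1 ij.2 (le_of_eq h2.symm), if_pos h2]
      · rw [map_zero, hg ij.1 ij.2 (le_of_not_gt h1), if_neg h2]
  exact RingHom.congr_fun this p

/-- The reduction of a monomial is `0` or the monomial of its upper part. -/
theorem red_monomial (m : Fin d × Fin d →₀ ℕ) :
    red d (monomial m 1) = 0 ∨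
      red d (monomial m 1) = monomial (m.filter fun ij : Fin d × Fin d => ij.1 < ij.2) 1 := by
  classical
  have e : red d (monomial m 1) = ∏ ij ∈ m.support,
      (if ij.1 < ij.2 then X ij else if ij.1 = ij.2 then (1 : A d) else 0) ^ m ij := by
    rw [MvPolynomial.monomial_eq, C_1, one_mul, Finsupp.prod, map_prod]
    refine Finset.prod_congr rfl fun ij _ => ?_
    rw [map_pow, red, aeval_X]
  by_cases h : ∃ ij ∈ m.support, ij.2 < ij.1
  · left
    obtain ⟨ij, hij, hlt⟩ := h
    rw [e]
    refine Finset.prod_eq_zero hij ?_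
    rw [if_neg (not_lt.mpr hlt.le), if_neg (ne_of_gt hlt), zero_pow]
    exact Finsupp.mem_support_iff.mp hij
  · right
    push Not at h
    rw [e, MvPolynomial.monomial_eq, C_1, one_mul, Finsupp.prod, Finsupp.support_filter, Finset.prod_filter]
    refine Finset.prod_congr rfl fun ij hij => ?_
    by_cases h1 : ij.1 < ij.2
    · rw [if_pos h1, if_pos h1, Finsupp.filter_apply, if_pos h1]
    · have h2 : ij.1 = ij.2 := le_antisymm (h ij hij) (not_lt.mp h1)
      rw [if_neg h1, if_pos h2, if_neg h1, one_pow]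

/-- The `x`-weight is monotone in the exponent vector. -/
theorem weight_xw_le_of_le {m m' : Fin d × Fin d →₀ ℕ} (h : m' ≤ m) :
    Finsupp.weight xw m' ≤ Finsupp.weight xw m := by
  obtain ⟨c, rfl⟩ := exists_add_of_le h
  rw [map_add]; exact Nat.le_add_right _ _

/-- The reduction of a polynomial of weighted degree `≤ s` is a combination of slices. -/
theorem red_mem_span (hd : 2 ≤ d) (s : ℕ) (p : A d)
    (hp : MvPolynomial.weightedTotalDegree (fun ij : Fin d × Fin d => (ij.2 : ℕ) - ij.1) p ≤ s) :
    red d p ∈ Submodule.span ℂ (Gens ((d - 1) * s + 1) (d - 1) s) := by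
  classical
  rw [p.as_sum, map_sum]
  refine Submodule.sum_mem _ fun m hm => ?_
  have e : monomial m (coeff m p) = coeff m p • (monomial m (1 : ℂ) : A d) := by
    rw [smul_monomial, smul_eq_mul, mul_one]
  rw [e, map_smul]
  refine Submodule.smul_mem _ _ ?_
  rcases red_monomial m with h | h
  · rw [h]; exact Submodule.zero_mem _
  · rw [h]
    have hw : Finsupp.weight xw (m.filter fun ij : Fin d × Fin d => ij.1 < ij.2) ≤ s := by
      refine (weight_xw_le_of_le (show (m.filter fun ij : Fin d × Fin d => ij.1 < ij.2) ≤ m from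
        fun i => by rw [Finsupp.filter_apply]; split_ifs; exacts [le_rfl, Nat.zero_le _])).trans ?_
      exact (MvPolynomial.le_weightedTotalDegree _ hm).trans hp
    have hdd : d - 1 < d := by omega
    have := main_span (d := d) (K := (d - 1) * s + 1) (by omega) (d - 1) hdd
      (m.filter fun ij : Fin d × Fin d => ij.1 < ij.2) (fun q hq => ?_) ?_
    · exact Submodule.span_mono (gens_mono _ le_rfl hw) this
    · rw [Finsupp.support_filter, Finset.mem_filter] at hq
      refine ⟨?_, hq.2, ?_⟩
      · rw [Fin.le_def, lo_val]; simp
      · rw [Fin.le_def]; simp only; omega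
    · calc Finsupp.weight xw _ ≤ s := hw
        _ < (d - 1) * s + 1 := Nat.lt_succ_of_le (Nat.le_mul_of_pos_left s (by omega))

/-- Explicit recipe: the reduction of `p` as a finite combination of slices with small data. -/
theorem exists_recipe (hd : 2 ≤ d) (s : ℕ) (p : A d)
    (hp : MvPolynomial.weightedTotalDegree (fun ij : Fin d × Fin d => (ij.2 : ℕ) - ij.1) p ≤ s) :
    ∃ (n : ℕ) (f : Fin n → ℂ) (α γ : Fin n → Var d →₀ ℕ),
      (∀ i, ∀ u ∈ (α i).support, d ≤ (u.row : ℕ) + u.col) ∧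
      (∀ i, Finsupp.weight Var.wt (α i) ≤ (d - 1) * s) ∧
      (∀ i, Finsupp.weight Var.wt (γ i) ≤ (d - 1) * s) ∧
      red d p = ∑ i, f i • Slice ((d - 1) * s + 1) (α i) (γ i) := by
  obtain ⟨n, f, g, hg⟩ := Submodule.mem_span_set'.mp (red_mem_span hd s p hp)
  have hdata : ∀ i, ∃ α γ : Var d →₀ ℕ, (∀ u ∈ α.support, d ≤ (u.row : ℕ) + u.col) ∧
      Finsupp.weight Var.wt α ≤ (d - 1) * s ∧ Finsupp.weight Var.wt γ ≤ (d - 1) * s ∧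
      (g i : A d) = Slice ((d - 1) * s + 1) α γ := by
    intro i
    obtain ⟨α, γ, h1, _, h3, h4, h5⟩ := (g i).2
    exact ⟨α, γ, fun u hu => (h1 u hu).2, h3, h4, h5⟩
  choose α γ h1 h2 h3 h4 using hdata
  refine ⟨n, f, α, γ, h1, h2, h3, ?_⟩
  rw [← hg]
  exact Finset.sum_congr rfl fun i _ => by rw [h4 i]

/-! ### The dimension count `2 · #q-variables + ⌊d/2⌋ ≤ d(d-1)/2` -/

/-- The three disjoint families of upper positions: `q`-positions, their row positions, corners. -/
def posOf (d : ℕ) : QIdx d ⊕ QIdx d ⊕ Fin (d / 2) → Fin d × Fin d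
  | Sum.inl u => (u.1.row, u.1.col)
  | Sum.inr (Sum.inl u) => (⟨d - 1 - u.1.col, by omega⟩, u.1.row)
  | Sum.inr (Sum.inr r) => (⟨r, by omega⟩, ⟨d - 1 - r, by omega⟩)

/-- The three families consist of upper positions. -/
theorem posOf_lt (x : QIdx d ⊕ QIdx d ⊕ Fin (d / 2)) : (posOf d x).1 < (posOf d x).2 := by
  rcases x with u | u | r
  · exact u.1.row_lt_col
  · show (⟨d - 1 - u.1.col, _⟩ : Fin d) < u.1.row
    rw [Fin.lt_def]
    have := u.2; have h5 : (Var.row u.1 : ℕ) < Var.col u.1 := u.1.row_lt_col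
    have h3 : (Var.col u.1 : ℕ) < d := (Var.col u.1).2
    show d - 1 - (Var.col u.1 : ℕ) < Var.row u.1
    omega
  · rw [Fin.lt_def]; show (r : ℕ) < d - 1 - r; omega

/-- The three families of upper positions are pairwise disjoint and injectively parametrised. -/
theorem posOf_injective : Function.Injective (posOf d) := by
  intro x y h
  rcases x with u | u | r <;> rcases y with u' | u' | r'
  · have h1 : ((Var.row u.1 : Fin d) : ℕ) = (Var.row u'.1 : ℕ) := congrArg (fun p : Fin d × Fin d => (p.1 : ℕ)) h
    have h2 : ((Var.col u.1 : Fin d) : ℕ) = (Var.col u'.1 : ℕ) := congrArg (fun p : Fin d × Fin d => (p.2 : ℕ)) h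
    congr 1; apply Subtype.ext; apply Subtype.ext; exact Prod.ext (Fin.ext h1) (Fin.ext h2)
  · exfalso
    have h1 : ((Var.row u.1 : Fin d) : ℕ) = d - 1 - (Var.col u'.1 : ℕ) :=
      congrArg (fun p : Fin d × Fin d => (p.1 : ℕ)) h
    have h2 : ((Var.col u.1 : Fin d) : ℕ) = (Var.row u'.1 : ℕ) := congrArg (fun p : Fin d × Fin d => (p.2 : ℕ)) h
    have := u.2; have := u'.2; have h5 : (Var.row u'.1 : ℕ) < Var.col u'.1 := u'.1.row_lt_col
    have h3 : (Var.col u'.1 : ℕ) < d := (Var.col u'.1).2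
    omega
  · exfalso
    have h1 : ((Var.row u.1 : Fin d) : ℕ) = (r' : ℕ) := congrArg (fun p : Fin d × Fin d => (p.1 : ℕ)) h
    have h2 : ((Var.col u.1 : Fin d) : ℕ) = d - 1 - (r' : ℕ) := congrArg (fun p : Fin d × Fin d => (p.2 : ℕ)) h
    have := u.2; have h4 : (r' : ℕ) < d / 2 := r'.2
    omega
  · exfalso
    have h1 : d - 1 - (Var.col u.1 : ℕ) = (Var.row u'.1 : ℕ) := congrArg (fun p : Fin d × Fin d => (p.1 : ℕ)) h
    have h2 : ((Var.row u.1 : Fin d) : ℕ) = (Var.col u'.1 : ℕ) := congrArg (fun p : Fin d × Fin d => (p.2 : ℕ)) h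
    have := u'.2; have := u.2; have h5 : (Var.row u.1 : ℕ) < Var.col u.1 := u.1.row_lt_col
    have h3 : (Var.col u.1 : ℕ) < d := (Var.col u.1).2
    omega
  · have h1 : d - 1 - (Var.col u.1 : ℕ) = d - 1 - (Var.col u'.1 : ℕ) :=
      congrArg (fun p : Fin d × Fin d => (p.1 : ℕ)) h
    have h2 : ((Var.row u.1 : Fin d) : ℕ) = (Var.row u'.1 : ℕ) := congrArg (fun p : Fin d × Fin d => (p.2 : ℕ)) h
    have h3 : (Var.col u.1 : ℕ) < d := (Var.col u.1).2
    have h4 : (Var.col u'.1 : ℕ) < d := (Var.col u'.1).2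
    congr 1; congr 1; apply Subtype.ext; apply Subtype.ext
    refine Prod.ext (Fin.ext h2) (Fin.ext ?_)
    show (Var.col u.1 : ℕ) = Var.col u'.1
    omega
  · exfalso
    have h1 : d - 1 - (Var.col u.1 : ℕ) = (r' : ℕ) := congrArg (fun p : Fin d × Fin d => (p.1 : ℕ)) h
    have h2 : ((Var.row u.1 : Fin d) : ℕ) = d - 1 - (r' : ℕ) := congrArg (fun p : Fin d × Fin d => (p.2 : ℕ)) h
    have := u.2; have h5 : (Var.row u.1 : ℕ) < Var.col u.1 := u.1.row_lt_col
    have h3 : (Var.col u.1 : ℕ) < d := (Var.col u.1).2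
    have h4 : (r' : ℕ) < d / 2 := r'.2
    omega
  · exfalso
    have h1 : (r : ℕ) = (Var.row u'.1 : ℕ) := congrArg (fun p : Fin d × Fin d => (p.1 : ℕ)) h
    have h2 : d - 1 - (r : ℕ) = (Var.col u'.1 : ℕ) := congrArg (fun p : Fin d × Fin d => (p.2 : ℕ)) h
    have := u'.2; have h4 : (r : ℕ) < d / 2 := r.2
    omega
  · exfalso
    have h1 : (r : ℕ) = d - 1 - (Var.col u'.1 : ℕ) := congrArg (fun p : Fin d × Fin d => (p.1 : ℕ)) h
    have h2 : d - 1 - (r : ℕ) = (Var.row u'.1 : ℕ) := congrArg (fun p : Fin d × Fin d => (p.2 : ℕ)) h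
    have := u'.2; have h5 : (Var.row u'.1 : ℕ) < Var.col u'.1 := u'.1.row_lt_col
    have h3 : (Var.col u'.1 : ℕ) < d := (Var.col u'.1).2
    have h4 : (r : ℕ) < d / 2 := r.2
    omega
  · have h1 : (r : ℕ) = (r' : ℕ) := congrArg (fun p : Fin d × Fin d => (p.1 : ℕ)) h
    congr 1; congr 1; exact Fin.ext h1

/-- An ordered pair is determined by its underlying two-element set. -/
theorem pair_injective {i j i' j' : Fin d} (hij : i < j) (hij' : i' < j')
    (h : ({i, j} : Finset (Fin d)) = {i', j'}) : i = i' ∧ j = j' := by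
  have hi : i ∈ ({i', j'} : Finset (Fin d)) := h ▸ Finset.mem_insert_self i {j}
  have hj : j ∈ ({i', j'} : Finset (Fin d)) := h ▸ Finset.mem_insert_of_mem (Finset.mem_singleton_self j)
  have hi' : i' ∈ ({i, j} : Finset (Fin d)) := h.symm ▸ Finset.mem_insert_self i' {j'}
  simp only [Finset.mem_insert, Finset.mem_singleton] at hi hj hi'
  rcases hi with hi | hi
  · refine ⟨hi, ?_⟩
    rcases hj with hj | hj
    · rw [hi, ← hj] at hij; exact absurd hij (lt_irrefl _)
    · exact hj
  · rcases hi' with hi' | hi'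
    · refine ⟨hi'.symm, ?_⟩
      rcases hj with hj | hj
      · rw [hj, hi'] at hij; exact absurd hij (lt_irrefl _)
      · exact hj
    · rw [hi'] at hij'; rw [hi] at hij; exact absurd (hij.trans hij') (lt_irrefl _)

/-- **Dimension count**: `2 · #(q-variables) + ⌊d/2⌋ ≤ C(d, 2)`. -/
theorem two_mul_card_qidx_add_le (d : ℕ) :
    2 * Fintype.card (QIdx d) + d / 2 ≤ d.choose 2 := by
  classical
  let H : QIdx d ⊕ QIdx d ⊕ Fin (d / 2) → Finset (Fin d) := fun x => {(posOf d x).1, (posOf d x).2}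
  have hH : ∀ x ∈ (Finset.univ : Finset (QIdx d ⊕ QIdx d ⊕ Fin (d / 2))),
      H x ∈ (Finset.univ : Finset (Fin d)).powersetCard 2 := by
    intro x _
    rw [Finset.mem_powersetCard]
    exact ⟨Finset.subset_univ _, Finset.card_pair (ne_of_lt (posOf_lt x))⟩
  have hinj : Set.InjOn H ↑(Finset.univ : Finset (QIdx d ⊕ QIdx d ⊕ Fin (d / 2))) := by
    intro x _ y _ hxy
    obtain ⟨h1, h2⟩ := pair_injective (posOf_lt x) (posOf_lt y) hxy
    exact posOf_injective (Prod.ext h1 h2)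
  have := Finset.card_le_card_of_injOn H hH hinj
  rw [Finset.card_univ, Finset.card_powersetCard, Finset.card_univ, Fintype.card_fin,
    Fintype.card_sum, Fintype.card_sum, Fintype.card_fin] at this
  omega

open MvPolynomial
open scoped BigOperators

variable {d : ℕ}

/-- Complexification of an integer matrix. -/
def cmat (g : Matrix.SpecialLinearGroup (Fin d) ℤ) : Matrix (Fin d) (Fin d) ℂ :=
  (g : Matrix (Fin d) (Fin d) ℤ).map (Int.castRingHom ℂ)

/-- Complexification is multiplicative. -/
theorem cmat_mul (g h : Matrix.SpecialLinearGroup (Fin d) ℤ) : cmat (g * h) = cmat g * cmat h := by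
  unfold cmat
  rw [Matrix.SpecialLinearGroup.coe_mul, Matrix.map_mul]

/-- Complexification preserves upper unitriangularity. -/
theorem cmat_ut {g : Matrix.SpecialLinearGroup (Fin d) ℤ}
    (hg : ∀ i j : Fin d, j ≤ i → (g : Matrix (Fin d) (Fin d) ℤ) i j = if i = j then 1 else 0) :
    ∀ i j : Fin d, j ≤ i → cmat g i j = if i = j then 1 else 0 := by
  intro i j hji
  unfold cmat
  rw [Matrix.map_apply, hg i j hji]
  split_ifs <;> simp

/-- The reading functional attached to a recipe. -/
def ell (T : ℕ) {n : ℕ} (f : Fin n → ℂ) (γ : Fin n → Var d →₀ ℕ)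
    (hγ : ∀ i, Finsupp.weight Var.wt (γ i) ≤ T) (a : Fin n → Idx d T) :
    Matrix (Fin (Fintype.card (Idx d T))) (Fin (Fintype.card (Idx d T))) (Rt d (T + 1)) →ₗ[ℂ] ℂ where
  toFun M := ∑ i, f i * coeffQ T (γ i) (hγ i)
    (phi T (M.mulVec (Pi.single (Fintype.equivFin (Idx d T) (a i)) 1)))
  map_add' M M' := by
    rw [← Finset.sum_add_distrib]
    refine Finset.sum_congr rfl fun i _ => ?_
    rw [Matrix.add_mulVec, phi_add, map_add, mul_add]
  map_smul' q M := by
    rw [RingHom.id_apply, Finset.smul_sum]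
    refine Finset.sum_congr rfl fun i _ => ?_
    rw [Matrix.smul_mulVec, phi_smul, map_smul, smul_eq_mul, smul_eq_mul]
    ring

/-- The number of generators is `(T+1)^{#q-variables}`. -/
theorem card_Idx (d T : ℕ) : Fintype.card (Idx d T) = (T + 1) ^ Fintype.card (QIdx d) := by
  rw [Fintype.card_fun, Fintype.card_fin]

/-- Landing hook of part 11: the dimension count. -/
theorem stub_pm_count : ∀ d : ℕ, 2 * Fintype.card (QIdx d) + d / 2 ≤ d.choose 2 :=
  fun d => two_mul_card_qidx_add_le d

end Summit.MatrixMultiplication.MatrixMultiplication.Theorems.UnitriangularCostShape.ProductModel
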